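import Mathlib
import Literature.Computability.AlgebraicComplexity.StandardFamilies
import Literature.Computability.AlgebraicComplexity.HessianAtOrigin
import Literature.Computability.AlgebraicComplexity.MignonRessayreBound
import Summits.ValiantsHypothesis.ValiantsHypothesis.Theorems.RefutationDegreeDefs
import Summits.ValiantsHypothesis.ValiantsHypothesis.Theorems.RefutationDegreeRefutationBarrierFanoByOne
import Summits.ValiantsHypothesis.ValiantsHypothesis.Theorems.RefutationDegreeBeyondHessianSosPlusTwo

/-!
# The affine BORDER determinantal complexity of the permanent: leading constant `5/9`
# (crux `BeyondHessianNs`, stmt-ValiantsHypothesis-5641, line `Sketch`)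

Helper file for crux item stmt-ValiantsHypothesis-5641.  The route's affine border model is
`InBorder n m` (`…Theorems.RefutationDegreeDefs`): `per_n` is a COEFFICIENTWISE LIMIT of determinants of
size-`m` affine pencils `A₀ + Σ_e x_e A_e`.  Landsberg–Manivel–Ressayre 2013 (Thm 1.1.1, border `dc ≥ n²/2`) was
re-proved in this model by the sibling line of crux `RefutationBarrier` (`sq_le_two_mul_of_inBorder`).  Here:

* `five_mul_sq_add_le_of_inBorder` — **`InBorder n m → 5n² + 41 ≤ 9m + 28n` for `n ≥ 4`**, i.e. the affine border
  determinantal complexity of `per_n` is `≥ (5n² - 28n + 41)/9`: the BORDER analogue of the sibling crux's exact bound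
  `…BeyondHessianSosPlusTwo.five_mul_sq_add_le_of_hasDetRepr_perPoly'` (`5n² + 50 ≤ 9M + 28n`), and an improvement of the
  leading constant of the quadratic border bound from `1/2` to `5/9` in this model (it overtakes `⌊n²/2⌋ + 1` at `n = 55`:
  `…BeyondHessianNsOfSkodaBrownawell.not_inBorder_sq_div_two_add_one`).
* `not_inBorder_of_lt` — contrapositive instance form.

Proof: the border-robust kernel plane (`…RefutationBarrierFanoByOne.sq_le_add_of_inBorder`: `InBorder n m` and "every
linear per-null subspace through the zero `y` has dimension `≤ d`" give `n² ≤ m + d`) at the Mignon–Ressayre zero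
`y₀ = J - nE₀₀`, where the flat bound `…BeyondHessianSosPlusTwo.nine_mul_finrank_flat_le` (border slicing + Kneser's
theorem for Hadamard products) gives `d = (4(n-1)² + 36(n-1) - 9)/9`, and `4(n-1)² + 36(n-1) - 9 = 4n² + 28n - 41`.
-/

noncomputable section

-- single-conjunct layout: Sub = Summit, duplicated namespace component intended
set_option linter.dupNamespace false

namespace Summit.ValiantsHypothesis.ValiantsHypothesis.Theorems.RefutationDegreeBeyondHessianNs

open MvPolynomial
open Literature.Computability.AlgebraicComplexity
open Summit.ValiantsHypothesis.ValiantsHypothesis.Theorems.RefutationDegree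
open Summit.ValiantsHypothesis.ValiantsHypothesis.Theorems.RefutationDegreeBeyondHessianSos
  (nine_mul_finrank_flat_le)

/-- **Affine border determinantal complexity of the permanent, leading constant `5/9`**: for `n ≥ 4`, if `per_n` is a
coefficientwise limit of determinants of size-`m` affine pencils (`InBorder n m`) then `5n² + 41 ≤ 9m + 28n`
(border-robust kernel plane at the Mignon–Ressayre zero + the flat bound `nine_mul_finrank_flat_le`). -/
theorem five_mul_sq_add_le_of_inBorder {n m : ℕ} (hn : 4 ≤ n) (h : InBorder n m) :
    5 * n ^ 2 + 41 ≤ 9 * m + 28 * n := by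
  obtain ⟨p, rfl⟩ : ∃ p, n = p + 3 := ⟨n - 3, by omega⟩
  have hb := sq_le_add_of_inBorder (d := (4 * (p + 2) ^ 2 + 36 * (p + 2) - 9) / 9) h (mrPoint ℂ p)
    eval_mrPoint_perPoly fun W hyW hW => by
      have h9 := nine_mul_finrank_flat_le p (by omega) W hyW hW
      omega
  have ha : (p + 3) ^ 2 = (p + 2) ^ 2 + 2 * (p + 2) + 1 := by ring
  have hb1 : 1 ≤ (p + 2) ^ 2 := Nat.one_le_pow _ _ (by omega)
  set a := (p + 3) ^ 2 with hadef
  set b := (p + 2) ^ 2 with hbdef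
  omega

/-- Contrapositive instance form: for `n ≥ 4` and `9m + 28n < 5n² + 41`, `per_n` is NOT a coefficientwise limit of
size-`m` affine determinants. -/
theorem not_inBorder_of_lt {n m : ℕ} (hn : 4 ≤ n) (hlt : 9 * m + 28 * n < 5 * n ^ 2 + 41) : ¬ InBorder n m :=
  fun h => absurd (five_mul_sq_add_le_of_inBorder hn h) (not_le.mpr hlt)

/-- **Registered form** (`stub_affineBorderBound` of crux item stmt-ValiantsHypothesis-5641): for `n ≥ 4`,
`InBorder n m → 5n² + 41 ≤ 9m + 28n`. -/
theorem stub_affineBorderBound : ∀ (n m : ℕ), 4 ≤ n → Summit.ValiantsHypothesis.ValiantsHypothesis.Theorems.RefutationDegree.InBorder n m → 5 * n ^ 2 + 41 ≤ 9 * m + 28 * n :=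
  fun _ _ hn h => five_mul_sq_add_le_of_inBorder hn h

end Summit.ValiantsHypothesis.ValiantsHypothesis.Theorems.RefutationDegreeBeyondHessianNs

end
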